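import Literature.MathematicalPhysics.QuantumFieldTheory.Balaban1983to89.B9Thm312WholeClasses

/-!
# `Balaban1983to89.B9PerturbationMajorantAlgebra` — [B9] p. 421 *"It is easy to find estimates for the operator Δ′_π using Theorem 3.1 and
# the inequality (3.49)"*: THE BLOCK-MAJORANT CALCULUS BEHIND (3.131) — the state classes 𝔠^{(s)} under scalars, composition and the p. 398 transfer,
# and THREE PRINTED-SHAPE HYPOTHESIS SCHEMAS: Thm 3.1 (3.42)₁₂₃ for G′, (3.49)₁₂₃ for P = I − R, the (3.117)∕(3.36) current letters B = ΔD_U, B† = D\*_UΔ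

T. Bałaban, *Propagators for lattice gauge theories in a background field*, Commun. Math. Phys. **99** (1985) 389–434 [`Balaban1985BackgroundPropagators`,
"B9"]; [4] = T. Bałaban, *Propagators and renormalization transformations for lattice gauge theories. II*, Commun. Math. Phys. **96** (1984) 223–250
[`Balaban1984PropagatorsII`].  statement-level skeleton of published theorems with citation tags; proofs where landed; nothing here is a claim about
the Yang–Mills mass gap.  PDF held (`paper:balaban1985-cmp99-background-propagators`, journal page = PDF page + 388); pp. 397–399, 421–423 re-read.

THE PRINT.  p. 397, Theorem 3.1, (3.42): *"|(G′(U)λ)(x)|, |(∇_UG′(U)λ)(x)|, |(G′(U)∇\*_Uλ)(x)|, |(Δ_UG′(U)λ)(x)| ≦ B₀[(Lʲη)², Lʲη, Lʲη, 1]e^{−δ₀d(y,y′)}|λ|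
for x ∈ Δ(y), y ∈ Λ_j, supp λ ⊂ Δ(y′)"*; p. 398: *"the choice of powers Lʲη is conventional also. Using Lemma 2.1 in [4] we may replace the factor (Lʲη)^α
by (Lʲη)^β(L^{j′}η)^γ with β + γ = α"*; p. 399, (3.49): *"For the operator P = I − R we obtain, using again Lemma 2.1, [|P(x, x′)|, |(DP)_μ(x, x′)|,
|(PD\*)_ν(x, x′)|, |(DPD\*)_{μν}(x, x′)|] ≦ O(1)[1, (Lʲη)⁻¹, (Lʲη)⁻¹, (Lʲη)⁻²](L^{j′}η)^{−d}e^{−½δ₀d(y,y′)}"*; p. 421: *"It is easy to find estimates for the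
operator Δ′_π using Theorem 3.1 and the inequality (3.49), we have to be careful only with the third term in the definition (3.120) of Δ′_π. One of the
three derivatives there has to be applied either to an expression on the right, or on the left, of Δ′_π"*; (3.131) p. 422.

THE POINT.  After dag-n06-l `B9PerturbationSplitAtLetters` (Δ′_π = T_a + D·T_b = T_a′ + T_b′·D\* with T_a = BG′RD\*, T_b = RG′B† − RG′D\*BG′RD\*,
T_a′ = DRG′B†, T_b′ = BG′R − DRG′D\*BG′R, B = Δ(U)∘D_U, B† = D\*_U∘Δ(U)) the Sect.-D certificate of rows 20–21 displays the MAJORANTS of these four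
composites.  Regrouped with every derivative adjacent to a G′ (print's instruction), they are words in SIX propagator letters and the two current letters:
T_a = B·𝒫, T_b = 𝒬·B† − 𝒮·B·𝒫, T_a′ = 𝒫†·B†, T_b′ = B·𝒬† − 𝒫†·B†·𝒮† with 𝒫 = G′RD\*, 𝒫† = DRG′, 𝒬 = RG′, 𝒬† = G′R, 𝒮 = RG′D\*, 𝒮† = DG′R.  THIS FILE
and its sequel majorise the six letters between the state classes 𝔠^{(s)} (`B9Thm312WholeClasses.cNormR`: size near y = (Lʲη)ˢ·sup_{Δ(y)}|·|) from three
HYPOTHESIS SCHEMAS of printed shape — `Thm31GpMaj` ((3.42)₁₂₃ for G′ with the gauge-sector derivatives D_U, D\*_U), `Proj349Maj` ((3.49)₁₂₃ read as [4]-(2.51)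
block majorants of P, DP, PD\*) and, for the sequel, `CurrentMaj` (B, B† of order (Lʲη)⁻³ — (3.117) with (3.36)) — by [4] (2.54) + Lemma 2.1 (2.61)
(`B11SectG.hasMaj_comp_exp`, cutting cost 1) and the scale transfer of p. 398 ([4] (2.60), n06-k's member facts `Facts347`), R := ϱ·(I − P):
* §1 the 𝔠^{(s)} calculus this needs: `ofBlocks_loc_smul ∕ cNormR_loc_smul ∕ hasMaj_smul_cNormR ∕ hasMaj_smul_exp` (scalars), `hasMaj_comp_cNormR` (composition through a
  state class), `hasMaj_shift` (the transfer (Lʲη)^γ, |γ| ≦ 4: rate loss αδ, constant L^{|γ|}), `hasMaj_weaken`, `hasMaj_sub_exp`, `hasMaj_ofR`, `hasMaj_cls_of_hom`;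
* §2 the schemas and their class readings (`gp_cls : G′ : 𝔠_W^{(0)} → 𝔠_W^{(−2)}`, `dvGp_cls`, `gpDvs_cls`, `p_cls`, `dvP_cls`, `pDvs_cls`, `b_cls`, `bd_cls`);
The six letters and the four T-letter majorants are the sequel `B9PerturbationMajorantLetters` (400-line rule); their reading at node00-def-Y's pinned
coordinate models (the four Δ′_π majorant hypotheses of the N06 certificate) is `B9PerturbationMajorantsAtLetters`.
HONEST SCOPE.  Kernel-checked bookkeeping over FREE finite carriers with block maps; Theorem 3.1, (3.49), (3.117)∕(3.36) are HYPOTHESIS SCHEMAS (nothing of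
[B9] or [4] asserted); count-neutral; N06 NOT discharged; one finite lattice at a time — nothing continuum ∕ ℝ⁴ ∕ OS ∕ mass gap ∕ Clay.  Cell `pub-ymgap`
(HUMAN RULING D-0062), Track A node N06 [B9], bundle F7 rows 20–21, seat `pub-ymgap-dag-n06-l` (g14), 2026-08-27.  NEW file; nothing landed is modified.
-/

namespace Literature.MathematicalPhysics.QuantumFieldTheory.Balaban1983to89.B9PerturbationMajorantAlgebra

open Literature.MathematicalPhysics.QuantumFieldTheory.Balaban1983to89
open Finset B6RandomWalk B6RandomWalkHom B9Thm34Ext B11SectG B9SectDSup B9Thm312Whole B9Thm312WholeClasses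
open B9Thm37AllNorms B9RWSums343to347Whole B9RWSums346Schur B9Ineq347

noncomputable section

variable {g : B9.Geometry} {X V XS XB : Type}
variable [Fintype X] [Fintype V] [Fintype XS] [Fintype XB] [Fintype g.Site]
variable {R₀ : ℝ} {H₀ : Prop}

/-! ## §1 The 𝔠^{(s)} calculus: scalars, composition through a state class, the scale transfer, weakening -/

/-- Kernel monotonicity: C·e^{−rd} ≦ C′·e^{−r′d} for 0 ≦ C ≦ C′, r′ ≦ r, d ≧ 0. [cite: Balaban1984PropagatorsII, (2.51) p.232 (bookkeeping)] -/
theorem kernel_le_of_le {C C' r r' d : ℝ} (hC : 0 ≤ C) (hCC' : C ≤ C') (hr : r' ≤ r) (hd : 0 ≤ d) :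
    C * Real.exp (-(r * d)) ≤ C' * Real.exp (-(r' * d)) :=
  calc C * Real.exp (-(r * d)) ≤ C * Real.exp (-(r' * d)) :=
      mul_le_mul_of_nonneg_left (Real.exp_le_exp.mpr (neg_le_neg (mul_le_mul_of_nonneg_right hr hd))) hC
    _ ≤ C' * Real.exp (-(r' * d)) := mul_le_mul_of_nonneg_right hCC' (Real.exp_nonneg _)

/-- `L^{|γ|} = Lⁿ` when `|γ| = n` (the constants of the integer transfers used here). [cite: Balaban1985BackgroundPropagators, p.398 (remark after (3.47)), bookkeeping] -/
theorem rpow_abs_eq_pow (L γ : ℝ) (n : ℕ) (h : |γ| = n) : L ^ |γ| = L ^ n := by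
  rw [h, Real.rpow_natCast]

/-- the sharp-block sup sizes are absolutely homogeneous: size of `r • f` near y = |r| × size of f. [cite: Balaban1984PropagatorsII, (2.51) p.232 (bookkeeping)] -/
theorem ofBlocks_loc_smul {G : B6.Geometry} (blk : X → G.Site) (y : G.Site) (r : ℝ) (f : X → ℝ) :
    (BlockNorm.ofBlocks G blk).loc y (r • f) = |r| * (BlockNorm.ofBlocks G blk).loc y f := by
  classical
  show (⨆ x : X, if blk x = y then |(r • f) x| else 0) = |r| * ⨆ x : X, if blk x = y then |f x| else 0
  rw [Real.mul_iSup_of_nonneg (abs_nonneg r)]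
  refine iSup_congr fun x => ?_
  split_ifs with hx
  · rw [Pi.smul_apply, smul_eq_mul, abs_mul]
  · rw [mul_zero]

/-- the state norm 𝔠^{(s)} is absolutely homogeneous. [cite: Balaban1985BackgroundPropagators, (3.42) p.397 (bookkeeping)] -/
theorem cNormR_loc_smul (blk : X → g.Site) (hlen : ∀ y : g.Site, 0 ≤ g.len y) (s : ℝ) (y : g.Site) (r : ℝ) (f : X → ℝ) :
    (cNormR R₀ H₀ blk hlen s).loc y (r • f) = |r| * (cNormR R₀ H₀ blk hlen s).loc y f := by
  rw [cNormR_loc, cNormR_loc, ofBlocks_loc_smul]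
  ring

/-- SCALARS: a majorant K of T into 𝔠^{(s)} is the majorant |r|·K of r•T. [cite: Balaban1984PropagatorsII, (2.51)–(2.52) p.232 (bookkeeping)] -/
theorem hasMaj_smul_cNormR {F : Type} [AddCommGroup F] [Module ℝ F] {b₁ : BlockNorm (toB6 g R₀ H₀) F} {blk : X → g.Site}
    {hlen : ∀ y : g.Site, 0 ≤ g.len y} {s : ℝ} {T : F →ₗ[ℝ] (X → ℝ)} {K : g.Site → g.Site → ℝ}
    (h : HasMaj b₁ (cNormR R₀ H₀ blk hlen s) T K) (r : ℝ) :
    HasMaj b₁ (cNormR R₀ H₀ blk hlen s) (r • T) (fun a b => |r| * K a b) := by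
  intro y' μ hμ y
  show (cNormR R₀ H₀ blk hlen s).loc y ((r • T) μ) ≤ |r| * K y y' * b₁.loc y' μ
  rw [LinearMap.smul_apply, cNormR_loc_smul, mul_assoc]
  exact mul_le_mul_of_nonneg_left (h y' μ hμ y) (abs_nonneg r)

/-- SCALARS on an exponential majorant: `w • T` has the majorant `|w|·C·e^{−rd}`. [cite: Balaban1984PropagatorsII, (2.51)–(2.52) p.232 (bookkeeping)] -/
theorem hasMaj_smul_exp {F : Type} [AddCommGroup F] [Module ℝ F] {b₁ : BlockNorm (toB6 g R₀ H₀) F} {blk : X → g.Site}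
    {hlen : ∀ y : g.Site, 0 ≤ g.len y} {s : ℝ} {T : F →ₗ[ℝ] (X → ℝ)} {C r : ℝ}
    (h : HasMaj b₁ (cNormR R₀ H₀ blk hlen s) T (fun a b => C * Real.exp (-(r * g.dist a b)))) (w : ℝ) :
    HasMaj b₁ (cNormR R₀ H₀ blk hlen s) (w • T) (fun a b => |w| * C * Real.exp (-(r * g.dist a b))) :=
  (hasMaj_smul_cNormR h w).mono fun a b => by
    show |w| * (C * Real.exp (-(r * g.dist a b))) ≤ |w| * C * Real.exp (-(r * g.dist a b))
    exact le_of_eq (mul_assoc _ _ _).symm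

/-- **COMPOSITION THROUGH A STATE CLASS** ([4] (2.52)–(2.56) + Lemma 2.1 (2.61) at the margin σ; the classes 𝔠^{(s)} cut at cost 1): T₁ (majorant
a₁e^{−ρ₁d} out of 𝔠^{(s)}) after T₂ (majorant a₂e^{−ρ₂d} into 𝔠^{(s)}) has the majorant a₁a₂c·e^{−ρd} for 0 ≦ ρ ≦ ρ₂, ρ + σ ≦ ρ₁.
[cite: Balaban1984PropagatorsII, (2.52)–(2.56) pp.232–233, Lemma 2.1 (2.61) p.234] -/
theorem hasMaj_comp_cNormR (hG : GeoOK g) {F₁ F₃ : Type} [AddCommGroup F₁] [Module ℝ F₁] [AddCommGroup F₃] [Module ℝ F₃]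
    {b₁ : BlockNorm (toB6 g R₀ H₀) F₁} {b₃ : BlockNorm (toB6 g R₀ H₀) F₃} {blk : X → g.Site} {s : ℝ}
    {T₁ : (X → ℝ) →ₗ[ℝ] F₃} {T₂ : F₁ →ₗ[ℝ] (X → ℝ)} {a₁ a₂ ρ₁ ρ₂ ρ σ c : ℝ} (hrow : RowSum (toB6 g R₀ H₀) σ c)
    (ha₁ : 0 ≤ a₁) (ha₂ : 0 ≤ a₂) (hρ : 0 ≤ ρ) (hρ₂ : ρ ≤ ρ₂) (hρ₁ : ρ + σ ≤ ρ₁)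
    (h₁ : HasMaj (cNormR R₀ H₀ blk hG.lenle s) b₃ T₁ (fun a b => a₁ * Real.exp (-(ρ₁ * g.dist a b))))
    (h₂ : HasMaj b₁ (cNormR R₀ H₀ blk hG.lenle s) T₂ (fun a b => a₂ * Real.exp (-(ρ₂ * g.dist a b)))) :
    HasMaj b₁ b₃ (T₁ ∘ₗ T₂) (fun a b => a₁ * a₂ * c * Real.exp (-(ρ * g.dist a b))) := by
  have htri : Triangle254 (toB6 g R₀ H₀) := fun a b c => hG.tri a b c
  refine (hasMaj_comp_exp htri hG.dnn hrow ha₁ ha₂ hρ hρ₂ hρ₁ h₁ h₂).mono fun a b => le_of_eq ?_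
  simp only [cNormR_κ, toB6_dist]
  ring

/-- **THE SCALE TRANSFER OF p. 398 WITH AN ADDITIVE RATE LOSS**: a majorant C·e^{−rd} from 𝔠_V^{(t)} to 𝔠^{(s)} is the majorant C·L^{|γ|}·e^{−(r−αδ)d} from
𝔠_V^{(t+γ)} to 𝔠^{(s+γ)}, |γ| ≦ 4, under the member facts ([4] (2.60) at the exponent α for the rate δ, 4·log L ≦ αδRM; n06-k
`B9RWSums346Schur.scaleTransfer_len_rpow`). [cite: Balaban1985BackgroundPropagators, p.398 (remark after (3.47)); Balaban1984PropagatorsII, Lemma 2.1 (2.60) p.234] -/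
theorem hasMaj_shift (hG : GeoOK g) {dF : ℕ} {δ α L₀ : ℝ} (hF : Facts347 g R₀ H₀ dF δ α L₀)
    {blkV : V → g.Site} {blk : X → g.Site} {T : (V → ℝ) →ₗ[ℝ] (X → ℝ)} {C r s t : ℝ} (γ : ℝ) (hγ : |γ| ≤ 4) (hC : 0 ≤ C)
    (h : HasMaj (cNormR R₀ H₀ blkV hG.lenle t) (cNormR R₀ H₀ blk hG.lenle s) T (fun a b => C * Real.exp (-(r * g.dist a b)))) :
    HasMaj (cNormR R₀ H₀ blkV hG.lenle (t + γ)) (cNormR R₀ H₀ blk hG.lenle (s + γ)) T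
      (fun a b => C * g.L ^ |γ| * Real.exp (-((r - α * δ) * g.dist a b))) := by
  intro y' μ hμ y
  have hb := h y' μ hμ y
  rw [cNormR_loc, cNormR_loc] at hb
  rw [cNormR_loc, cNormR_loc, Real.rpow_add (hG.lenpos y), Real.rpow_add (hG.lenpos y')]
  set N := (BlockNorm.ofBlocks (toB6 g R₀ H₀) blk).loc y (T μ) with hN
  set N' := (BlockNorm.ofBlocks (toB6 g R₀ H₀) blkV).loc y' μ with hN'
  have hN'0 : 0 ≤ N' := (BlockNorm.ofBlocks (toB6 g R₀ H₀) blkV).loc_nonneg y' μ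
  have hγ0 : 0 ≤ g.len y ^ γ := Real.rpow_nonneg (hG.lenle y) γ
  have ht0 : 0 ≤ g.len y' ^ t := Real.rpow_nonneg (hG.lenle y') t
  -- the transfer at (y′, y): e^{−αδd(y,y′)} (Lʲη)^γ ≦ L^{|γ|} (L^{j′}η)^γ
  have hst : Real.exp (-(α * δ * g.dist y y')) * g.len y ^ γ ≤ g.L ^ |γ| * g.len y' ^ γ := by
    have h1 := scaleTransfer_len_rpow hF γ hγ y' y
    rw [hG.symm y' y] at h1
    exact h1
  have hsplit : Real.exp (-(r * g.dist y y')) =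
      Real.exp (-((r - α * δ) * g.dist y y')) * Real.exp (-(α * δ * g.dist y y')) := by
    rw [← Real.exp_add]; congr 1; ring
  have hE : 0 ≤ C * Real.exp (-((r - α * δ) * g.dist y y')) := mul_nonneg hC (Real.exp_nonneg _)
  calc g.len y ^ s * g.len y ^ γ * N = g.len y ^ γ * (g.len y ^ s * N) := by ring
    _ ≤ g.len y ^ γ * (C * Real.exp (-(r * g.dist y y')) * (g.len y' ^ t * N')) := mul_le_mul_of_nonneg_left hb hγ0
    _ = C * Real.exp (-((r - α * δ) * g.dist y y')) * (Real.exp (-(α * δ * g.dist y y')) * g.len y ^ γ) *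
          (g.len y' ^ t * N') := by rw [hsplit]; ring
    _ ≤ C * Real.exp (-((r - α * δ) * g.dist y y')) * (g.L ^ |γ| * g.len y' ^ γ) * (g.len y' ^ t * N') :=
        mul_le_mul_of_nonneg_right (mul_le_mul_of_nonneg_left hst hE) (mul_nonneg ht0 hN'0)
    _ = C * g.L ^ |γ| * Real.exp (-((r - α * δ) * g.dist y y')) * (g.len y' ^ t * g.len y' ^ γ * N') := by ring

/-- WEAKENING a majorant C·e^{−rd}: larger constant, smaller rate. [cite: Balaban1984PropagatorsII, (2.51) p.232 (bookkeeping)] -/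
theorem hasMaj_weaken (hG : GeoOK g) {F₁ F₂ : Type} [AddCommGroup F₁] [Module ℝ F₁] [AddCommGroup F₂] [Module ℝ F₂]
    {b₁ : BlockNorm (toB6 g R₀ H₀) F₁} {b₂ : BlockNorm (toB6 g R₀ H₀) F₂} {T : F₁ →ₗ[ℝ] F₂} {C C' r r' : ℝ}
    (hC : 0 ≤ C) (hCC' : C ≤ C') (hr : r' ≤ r)
    (h : HasMaj b₁ b₂ T (fun a b => C * Real.exp (-(r * g.dist a b)))) :
    HasMaj b₁ b₂ T (fun a b => C' * Real.exp (-(r' * g.dist a b))) :=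
  h.mono fun a b => kernel_le_of_le hC hCC' hr (hG.dnn a b)

/-- DIFFERENCES at a common rate: constants add. [cite: Balaban1984PropagatorsII, p.232 («A summation preserves it also»)] -/
theorem hasMaj_sub_exp {F₁ F₂ : Type} [AddCommGroup F₁] [Module ℝ F₁] [AddCommGroup F₂] [Module ℝ F₂]
    {b₁ : BlockNorm (toB6 g R₀ H₀) F₁} {b₂ : BlockNorm (toB6 g R₀ H₀) F₂} {T₁ T₂ : F₁ →ₗ[ℝ] F₂} {C₁ C₂ r : ℝ}
    (h₁ : HasMaj b₁ b₂ T₁ (fun a b => C₁ * Real.exp (-(r * g.dist a b))))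
    (h₂ : HasMaj b₁ b₂ T₂ (fun a b => C₂ * Real.exp (-(r * g.dist a b)))) :
    HasMaj b₁ b₂ (T₁ - T₂) (fun a b => (C₁ + C₂) * Real.exp (-(r * g.dist a b))) :=
  (h₁.sub h₂).mono fun a b => by
    show C₁ * Real.exp (-(r * g.dist a b)) + C₂ * Real.exp (-(r * g.dist a b)) ≤ (C₁ + C₂) * Real.exp (-(r * g.dist a b))
    exact le_of_eq (by ring)

/-- A majorant between 𝔠^{(−q)} and 𝔠^{(−p)} (q, p ∈ ℕ) is the same majorant between the integer-weight state norms `cNorm … q → cNorm … p`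
(converse of `B9Thm312WholeClasses.hasMaj_toR`). [cite: Balaban1985BackgroundPropagators, (3.42) p.397 (bookkeeping)] -/
theorem hasMaj_ofR (hG : GeoOK g) {blkV : V → g.Site} {blk : X → g.Site} {T : (V → ℝ) →ₗ[ℝ] (X → ℝ)}
    {K : g.Site → g.Site → ℝ} {p q : ℕ}
    (h : HasMaj (cNormR R₀ H₀ blkV hG.lenle (-(q : ℝ))) (cNormR R₀ H₀ blk hG.lenle (-(p : ℝ))) T K) :
    HasMaj (cNorm R₀ H₀ blkV hG.lenle q) (cNorm R₀ H₀ blk hG.lenle p) T K := by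
  intro y' μ hμ y
  rw [← cNormR_loc_neg_natCast hG, ← cNormR_loc_neg_natCast hG]
  exact h y' μ hμ y

/-- Reading a [4]-(2.51) two-space sup majorant `C·(Lʲη)^s·e^{−rd}` (power at the OUTPUT block, C ≧ 0) as the majorant C·e^{−rd} from 𝔠_V^{(0)} into 𝔠^{(−s)}.
[cite: Balaban1985BackgroundPropagators, (3.42) p.397 + p.398 (remark after (3.47)); Balaban1984PropagatorsII, (2.51) p.232] -/
theorem hasMaj_cls_of_hom (hG : GeoOK g) {blkV : V → g.Site} {blk : X → g.Site} {T : (V → ℝ) →ₗ[ℝ] (X → ℝ)} {C r : ℝ} (s : ℝ)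
    (hC : 0 ≤ C) (h : HasMajorantHom (g := toB6 g R₀ H₀) blkV blk T (fun (a b : g.Site) => C * g.len a ^ s * Real.exp (-(r * g.dist a b)))) :
    HasMaj (cNormR R₀ H₀ blkV hG.lenle 0) (cNormR R₀ H₀ blk hG.lenle (-s)) T (fun a b => C * Real.exp (-(r * g.dist a b))) := by
  refine hasMaj_cNormR_of_hasMajorantHom hG (fun a b => mul_nonneg hC (Real.exp_nonneg _)) s 0 ?_
  refine hasMajorantHom_mono (g := toB6 g R₀ H₀) blkV blk h fun a b => le_of_eq ?_
  show C * g.len a ^ s * Real.exp (-(r * g.dist a b)) = C * Real.exp (-(r * g.dist a b)) * g.len a ^ s * g.len b ^ (0 : ℝ)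
  rw [Real.rpow_zero, mul_one]
  ring

/-! ## §2 The three hypothesis schemas of printed shape and their readings between the state classes -/

/-- **THEOREM 3.1, ENTRIES (3.42)₁,₂,₃, FOR THE SITE PROPAGATOR G′(U) WITH THE GAUGE-SECTOR DERIVATIVES**, in the [4]-(2.51) shapes over a site carrier
(`blkW`) and a bond carrier (`blk`): |(G′λ)(x)| ≦ B₀(Lʲη)²e^{−δ₀d(y,y′)}|λ| (`e0`), |(D_UG′λ)(b)| ≦ B₀Lʲη·e^{−δ₀d}|λ| (`e1`), |(G′D\*_UA)(x)| ≦ B₀Lʲη·e^{−δ₀d}|A|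
(`e2`), for x, b ∈ Δ(y), supp ⊂ Δ(y′) — D_U of (3.3) IS the covariant derivative ∇_U of site functions, D\*_U of (3.8) its adjoint.  The pattern of
`B9Thm312Whole.Thm33G0`, for G′ instead of G₀.  A HYPOTHESIS SCHEMA (Theorem 3.1 is the knit's leaf `t31` ∕ the output of Thm 3.7, not asserted).
[cite: Balaban1985BackgroundPropagators, Thm 3.1 (3.42) p.397, (3.3) p.390, (3.8) p.392] -/
structure Thm31GpMaj (blkW : XS → g.Site) (blk : XB → g.Site) (Gp : Module.End ℝ (XS → ℝ)) (Dv : (XS → ℝ) →ₗ[ℝ] (XB → ℝ))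
    (Dvs : (XB → ℝ) →ₗ[ℝ] (XS → ℝ)) (R₀ : ℝ) (H₀ : Prop) (B₀ δ₀ : ℝ) : Prop where
  e0 : HasMajorant (g := toB6 g R₀ H₀) blkW Gp (fun (a b : g.Site) => B₀ * g.len a ^ 2 * Real.exp (-(δ₀ * g.dist a b)))
  e1 : HasMajorantHom (g := toB6 g R₀ H₀) blkW blk (Dv ∘ₗ Gp) (fun (a b : g.Site) => B₀ * g.len a * Real.exp (-(δ₀ * g.dist a b)))
  e2 : HasMajorantHom (g := toB6 g R₀ H₀) blk blkW (Gp ∘ₗ Dvs) (fun (a b : g.Site) => B₀ * g.len a * Real.exp (-(δ₀ * g.dist a b)))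

/-- **(3.49)₁,₂,₃ FOR P = I − R, READ AS [4]-(2.51) BLOCK MAJORANTS**: the printed kernel bounds [|P(x,x′)|, |(DP)(x,x′)|, |(PD\*)(x,x′)|] ≦
O(1)[1, (Lʲη)⁻¹, (Lʲη)⁻¹](L^{j′}η)^{−d}e^{−½δ₀d(y,y′)}, summed over an input block Δ(y′) (η^d·#Δ(y′)·(L^{j′}η)^{−d} = O(1)), are operator majorants
|(Pλ)(x)| ≦ C_P·e^{−δ_P d(y,y′)}|λ| (`p0`), |(D_UPλ)(b)| ≦ C_P(Lʲη)⁻¹e^{−δ_P d}|λ| (`p1`), |(PD\*_UA)(x)| ≦ C_P(Lʲη)⁻¹e^{−δ_P d}|A| (`p2`) for supports in Δ(y′).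
A HYPOTHESIS SCHEMA (at NODE 00's instance: row 25 of the N06 table, n06-i `B9Ineq349SiteFromBlocks.stmt349Printed_site_of_blockSchemas`, read for the model
of def-Y's `P349Y`); nothing asserted. [cite: Balaban1985BackgroundPropagators, (3.49) p.399, (3.21) p.394; Balaban1984PropagatorsII, (2.51) p.232] -/
structure Proj349Maj (blkW : XS → g.Site) (blk : XB → g.Site) (P : Module.End ℝ (XS → ℝ)) (Dv : (XS → ℝ) →ₗ[ℝ] (XB → ℝ))
    (Dvs : (XB → ℝ) →ₗ[ℝ] (XS → ℝ)) (R₀ : ℝ) (H₀ : Prop) (CP δP : ℝ) : Prop where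
  p0 : HasMajorant (g := toB6 g R₀ H₀) blkW P (fun (a b : g.Site) => CP * Real.exp (-(δP * g.dist a b)))
  p1 : HasMajorantHom (g := toB6 g R₀ H₀) blkW blk (Dv ∘ₗ P) (fun (a b : g.Site) => CP * (g.len a)⁻¹ * Real.exp (-(δP * g.dist a b)))
  p2 : HasMajorantHom (g := toB6 g R₀ H₀) blk blkW (P ∘ₗ Dvs) (fun (a b : g.Site) => CP * (g.len a)⁻¹ * Real.exp (-(δP * g.dist a b)))

/-- **THE CURRENT LETTERS B = Δ(U)∘D_U AND B† = D\*_U∘Δ(U) OF (3.117), WITH (3.36)**: the Hessian (3.10) on a pure gauge mode is an ORDER-ZERO operator whose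
coefficient is the current J = D\*η⁻²Im ∂U — (3.117): (ΔD_Uλ)(b) = (i∕2)[J(b), λ(b₋) + R(U_b)λ(b₊)] (kernel-checked on the NE9 carriers:
`B9Eq3117HessOpGaugeMode.equiv_hessOp_covDerivL2K`, transpose `B9Eq3117DivHessOpGaugeMode`) — and |J| ≦ O(1)Mα₀(Lʲη)⁻³ under (3.36)
(`B9Eq336CurrentBound.norm_J_le_blocks`); hence |(Bλ)(b)| ≦ t_B(Lʲη)⁻³e^{−δ_B d(y,y′)}|λ| and the same for B† (b ∈ Δ(y), supp ⊂ Δ(y′); B has range one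
lattice step, so any δ_B serves with t_B = O(1)·Mα₀·e^{O(δ_B)}).  A HYPOTHESIS SCHEMA; at def-Y's letters `hessY U ∘ gradY U`, `divY U ∘ hessY U` its
derivation is the (3.117) carrier bridge (dag-n06-l HANDOFF g13), not typed here. [cite: Balaban1985BackgroundPropagators, (3.117) p.419, (3.36) p.396, (3.10)–(3.11) p.392, p.422] -/
structure CurrentMaj (blkW : XS → g.Site) (blk : XB → g.Site) (Bop : (XS → ℝ) →ₗ[ℝ] (XB → ℝ)) (Bdop : (XB → ℝ) →ₗ[ℝ] (XS → ℝ))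
    (R₀ : ℝ) (H₀ : Prop) (tB δB : ℝ) : Prop where
  b : HasMajorantHom (g := toB6 g R₀ H₀) blkW blk Bop (fun (a b : g.Site) => tB * (g.len a ^ 3)⁻¹ * Real.exp (-(δB * g.dist a b)))
  bd : HasMajorantHom (g := toB6 g R₀ H₀) blk blkW Bdop (fun (a b : g.Site) => tB * (g.len a ^ 3)⁻¹ * Real.exp (-(δB * g.dist a b)))

section Readings

variable {blkW : XS → g.Site} {blk : XB → g.Site} {Gp P : Module.End ℝ (XS → ℝ)} {Dv Bop : (XS → ℝ) →ₗ[ℝ] (XB → ℝ)}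
  {Dvs Bdop : (XB → ℝ) →ₗ[ℝ] (XS → ℝ)} {B₀ δ₀ CP δP tB δB r : ℝ}

omit [Fintype XB] in
/-- (3.42)₁ for G′ as a map of state classes: G′ : 𝔠_W^{(0)} → 𝔠_W^{(−2)}, constant B₀, any rate r ≦ δ₀. [cite: Balaban1985BackgroundPropagators, (3.42) p.397] -/
theorem Thm31GpMaj.gp_cls (hG : GeoOK g) (h : Thm31GpMaj blkW blk Gp Dv Dvs R₀ H₀ B₀ δ₀) (hB₀ : 0 ≤ B₀) (hr : r ≤ δ₀) :
    HasMaj (cNormR R₀ H₀ blkW hG.lenle 0) (cNormR R₀ H₀ blkW hG.lenle (-2)) Gp (fun a b => B₀ * Real.exp (-(r * g.dist a b))) := by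
  have h0 : HasMajorantHom (g := toB6 g R₀ H₀) blkW blkW Gp
      (fun (a b : g.Site) => B₀ * g.len a ^ (2 : ℝ) * Real.exp (-(δ₀ * g.dist a b))) := by
    refine hasMajorantHom_mono (g := toB6 g R₀ H₀) blkW blkW ((hasMajorantHom_iff (g := toB6 g R₀ H₀) blkW Gp _).mpr h.e0)
      fun a b => le_of_eq ?_
    show B₀ * g.len a ^ 2 * Real.exp (-(δ₀ * g.dist a b)) = B₀ * g.len a ^ (2 : ℝ) * Real.exp (-(δ₀ * g.dist a b))
    rw [Real.rpow_two]
  exact hasMaj_weaken hG hB₀ le_rfl hr (hasMaj_cls_of_hom hG 2 hB₀ h0)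

/-- (3.42)₂ for G′: D_UG′ : 𝔠_W^{(0)} → 𝔠^{(−1)}, constant B₀, rate r ≦ δ₀. [cite: Balaban1985BackgroundPropagators, (3.42) p.397] -/
theorem Thm31GpMaj.dvGp_cls (hG : GeoOK g) (h : Thm31GpMaj blkW blk Gp Dv Dvs R₀ H₀ B₀ δ₀) (hB₀ : 0 ≤ B₀) (hr : r ≤ δ₀) :
    HasMaj (cNormR R₀ H₀ blkW hG.lenle 0) (cNormR R₀ H₀ blk hG.lenle (-1)) (Dv ∘ₗ Gp) (fun a b => B₀ * Real.exp (-(r * g.dist a b))) := by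
  have h0 : HasMajorantHom (g := toB6 g R₀ H₀) blkW blk (Dv ∘ₗ Gp)
      (fun (a b : g.Site) => B₀ * g.len a ^ (1 : ℝ) * Real.exp (-(δ₀ * g.dist a b))) := by
    refine hasMajorantHom_mono (g := toB6 g R₀ H₀) blkW blk h.e1 fun a b => le_of_eq ?_
    show B₀ * g.len a * Real.exp (-(δ₀ * g.dist a b)) = B₀ * g.len a ^ (1 : ℝ) * Real.exp (-(δ₀ * g.dist a b))
    rw [Real.rpow_one]
  exact hasMaj_weaken hG hB₀ le_rfl hr (hasMaj_cls_of_hom hG 1 hB₀ h0)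

/-- (3.42)₃ for G′: G′D\*_U : 𝔠^{(0)} → 𝔠_W^{(−1)}, constant B₀, rate r ≦ δ₀. [cite: Balaban1985BackgroundPropagators, (3.42) p.397] -/
theorem Thm31GpMaj.gpDvs_cls (hG : GeoOK g) (h : Thm31GpMaj blkW blk Gp Dv Dvs R₀ H₀ B₀ δ₀) (hB₀ : 0 ≤ B₀) (hr : r ≤ δ₀) :
    HasMaj (cNormR R₀ H₀ blk hG.lenle 0) (cNormR R₀ H₀ blkW hG.lenle (-1)) (Gp ∘ₗ Dvs) (fun a b => B₀ * Real.exp (-(r * g.dist a b))) := by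
  have h0 : HasMajorantHom (g := toB6 g R₀ H₀) blk blkW (Gp ∘ₗ Dvs)
      (fun (a b : g.Site) => B₀ * g.len a ^ (1 : ℝ) * Real.exp (-(δ₀ * g.dist a b))) := by
    refine hasMajorantHom_mono (g := toB6 g R₀ H₀) blk blkW h.e2 fun a b => le_of_eq ?_
    show B₀ * g.len a * Real.exp (-(δ₀ * g.dist a b)) = B₀ * g.len a ^ (1 : ℝ) * Real.exp (-(δ₀ * g.dist a b))
    rw [Real.rpow_one]
  exact hasMaj_weaken hG hB₀ le_rfl hr (hasMaj_cls_of_hom hG 1 hB₀ h0)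

omit [Fintype XB] in
/-- (3.49)₁: P : 𝔠_W^{(0)} → 𝔠_W^{(0)}, constant C_P, rate r ≦ δ_P. [cite: Balaban1985BackgroundPropagators, (3.49) p.399] -/
theorem Proj349Maj.p_cls (hG : GeoOK g) (h : Proj349Maj blkW blk P Dv Dvs R₀ H₀ CP δP) (hCP : 0 ≤ CP) (hr : r ≤ δP) :
    HasMaj (cNormR R₀ H₀ blkW hG.lenle 0) (cNormR R₀ H₀ blkW hG.lenle 0) P (fun a b => CP * Real.exp (-(r * g.dist a b))) := by
  have h0 : HasMajorantHom (g := toB6 g R₀ H₀) blkW blkW P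
      (fun (a b : g.Site) => CP * g.len a ^ (0 : ℝ) * Real.exp (-(δP * g.dist a b))) := by
    refine hasMajorantHom_mono (g := toB6 g R₀ H₀) blkW blkW ((hasMajorantHom_iff (g := toB6 g R₀ H₀) blkW P _).mpr h.p0)
      fun a b => le_of_eq ?_
    show CP * Real.exp (-(δP * g.dist a b)) = CP * g.len a ^ (0 : ℝ) * Real.exp (-(δP * g.dist a b))
    rw [Real.rpow_zero, mul_one]
  have h1 := hasMaj_cls_of_hom hG 0 hCP h0
  rw [neg_zero] at h1
  exact hasMaj_weaken hG hCP le_rfl hr h1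

/-- (3.49)₂: D_UP : 𝔠_W^{(0)} → 𝔠^{(1)}, constant C_P, rate r ≦ δ_P. [cite: Balaban1985BackgroundPropagators, (3.49) p.399] -/
theorem Proj349Maj.dvP_cls (hG : GeoOK g) (h : Proj349Maj blkW blk P Dv Dvs R₀ H₀ CP δP) (hCP : 0 ≤ CP) (hr : r ≤ δP) :
    HasMaj (cNormR R₀ H₀ blkW hG.lenle 0) (cNormR R₀ H₀ blk hG.lenle 1) (Dv ∘ₗ P) (fun a b => CP * Real.exp (-(r * g.dist a b))) := by
  have h0 : HasMajorantHom (g := toB6 g R₀ H₀) blkW blk (Dv ∘ₗ P)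
      (fun (a b : g.Site) => CP * g.len a ^ (-1 : ℝ) * Real.exp (-(δP * g.dist a b))) := by
    refine hasMajorantHom_mono (g := toB6 g R₀ H₀) blkW blk h.p1 fun a b => le_of_eq ?_
    show CP * (g.len a)⁻¹ * Real.exp (-(δP * g.dist a b)) = CP * g.len a ^ (-1 : ℝ) * Real.exp (-(δP * g.dist a b))
    rw [Real.rpow_neg_one]
  have h1 := hasMaj_cls_of_hom hG (-1) hCP h0
  rw [neg_neg] at h1
  exact hasMaj_weaken hG hCP le_rfl hr h1

/-- (3.49)₃: PD\*_U : 𝔠^{(0)} → 𝔠_W^{(1)}, constant C_P, rate r ≦ δ_P. [cite: Balaban1985BackgroundPropagators, (3.49) p.399] -/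
theorem Proj349Maj.pDvs_cls (hG : GeoOK g) (h : Proj349Maj blkW blk P Dv Dvs R₀ H₀ CP δP) (hCP : 0 ≤ CP) (hr : r ≤ δP) :
    HasMaj (cNormR R₀ H₀ blk hG.lenle 0) (cNormR R₀ H₀ blkW hG.lenle 1) (P ∘ₗ Dvs) (fun a b => CP * Real.exp (-(r * g.dist a b))) := by
  have h0 : HasMajorantHom (g := toB6 g R₀ H₀) blk blkW (P ∘ₗ Dvs)
      (fun (a b : g.Site) => CP * g.len a ^ (-1 : ℝ) * Real.exp (-(δP * g.dist a b))) := by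
    refine hasMajorantHom_mono (g := toB6 g R₀ H₀) blk blkW h.p2 fun a b => le_of_eq ?_
    show CP * (g.len a)⁻¹ * Real.exp (-(δP * g.dist a b)) = CP * g.len a ^ (-1 : ℝ) * Real.exp (-(δP * g.dist a b))
    rw [Real.rpow_neg_one]
  have h1 := hasMaj_cls_of_hom hG (-1) hCP h0
  rw [neg_neg] at h1
  exact hasMaj_weaken hG hCP le_rfl hr h1

/-- the current letter B : 𝔠_W^{(0)} → 𝔠^{(3)}, constant t_B, rate r ≦ δ_B. [cite: Balaban1985BackgroundPropagators, (3.117) p.419, (3.36) p.396] -/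
theorem CurrentMaj.b_cls (hG : GeoOK g) (h : CurrentMaj blkW blk Bop Bdop R₀ H₀ tB δB) (htB : 0 ≤ tB) (hr : r ≤ δB) :
    HasMaj (cNormR R₀ H₀ blkW hG.lenle 0) (cNormR R₀ H₀ blk hG.lenle 3) Bop (fun a b => tB * Real.exp (-(r * g.dist a b))) := by
  have h0 : HasMajorantHom (g := toB6 g R₀ H₀) blkW blk Bop
      (fun (a b : g.Site) => tB * g.len a ^ (-3 : ℝ) * Real.exp (-(δB * g.dist a b))) := by
    refine hasMajorantHom_mono (g := toB6 g R₀ H₀) blkW blk h.b fun a b => le_of_eq ?_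
    show tB * (g.len a ^ 3)⁻¹ * Real.exp (-(δB * g.dist a b)) = tB * g.len a ^ (-3 : ℝ) * Real.exp (-(δB * g.dist a b))
    rw [Real.rpow_neg (hG.lenle a), Real.rpow_ofNat]
  have h1 := hasMaj_cls_of_hom hG (-3) htB h0
  rw [neg_neg] at h1
  exact hasMaj_weaken hG htB le_rfl hr h1

/-- the transposed current letter B† : 𝔠^{(0)} → 𝔠_W^{(3)}, constant t_B, rate r ≦ δ_B. [cite: Balaban1985BackgroundPropagators, (3.117) p.419, p.421, (3.36) p.396] -/
theorem CurrentMaj.bd_cls (hG : GeoOK g) (h : CurrentMaj blkW blk Bop Bdop R₀ H₀ tB δB) (htB : 0 ≤ tB) (hr : r ≤ δB) :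
    HasMaj (cNormR R₀ H₀ blk hG.lenle 0) (cNormR R₀ H₀ blkW hG.lenle 3) Bdop (fun a b => tB * Real.exp (-(r * g.dist a b))) := by
  have h0 : HasMajorantHom (g := toB6 g R₀ H₀) blk blkW Bdop
      (fun (a b : g.Site) => tB * g.len a ^ (-3 : ℝ) * Real.exp (-(δB * g.dist a b))) := by
    refine hasMajorantHom_mono (g := toB6 g R₀ H₀) blk blkW h.bd fun a b => le_of_eq ?_
    show tB * (g.len a ^ 3)⁻¹ * Real.exp (-(δB * g.dist a b)) = tB * g.len a ^ (-3 : ℝ) * Real.exp (-(δB * g.dist a b))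
    rw [Real.rpow_neg (hG.lenle a), Real.rpow_ofNat]
  have h1 := hasMaj_cls_of_hom hG (-3) htB h0
  rw [neg_neg] at h1
  exact hasMaj_weaken hG htB le_rfl hr h1

end Readings

/-! ## §3 The common constant of the six propagator letters of the sequel -/

/-- the common constant of the six letters: `ϱ·B₀·(1 + L²·C_P·c)` (ϱ the scalar of R = ϱ(I − P) in the model, c the row-sum constant of (2.61)).
[cite: Balaban1985BackgroundPropagators, p.421 + (3.42) p.397 + (3.49) p.399 (bookkeeping)] -/
def constA (ϱ B₀ CP c L : ℝ) : ℝ := ϱ * B₀ * (1 + L ^ 2 * CP * c)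

/-- `0 ≦ constA` for non-negative data. [cite: Balaban1985BackgroundPropagators, p.421 (bookkeeping)] -/
theorem constA_nonneg {ϱ B₀ CP c L : ℝ} (hϱ : 0 ≤ ϱ) (hB₀ : 0 ≤ B₀) (hCP : 0 ≤ CP) (hc : 0 ≤ c) : 0 ≤ constA ϱ B₀ CP c L := by
  have h : 0 ≤ L ^ 2 * CP * c := mul_nonneg (mul_nonneg (sq_nonneg L) hCP) hc
  exact mul_nonneg (mul_nonneg hϱ hB₀) (by linarith)

/-- `ϱ·B₀·(1 + Lⁿ·C_P·c) ≦ constA` for n ≦ 2 and L ≧ 1 (the letters' own constants against the common one). [cite: Balaban1985BackgroundPropagators, p.421 (bookkeeping)] -/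
theorem le_constA {ϱ B₀ CP c L : ℝ} (hϱ : 0 ≤ ϱ) (hB₀ : 0 ≤ B₀) (hCP : 0 ≤ CP) (hc : 0 ≤ c) (hL : 1 ≤ L) {n : ℕ} (hn : n ≤ 2) :
    ϱ * B₀ * (1 + L ^ n * CP * c) ≤ constA ϱ B₀ CP c L := by
  unfold constA
  have hLn : L ^ n ≤ L ^ 2 := pow_le_pow_right₀ hL hn
  have h1 : L ^ n * (CP * c) ≤ L ^ 2 * (CP * c) := mul_le_mul_of_nonneg_right hLn (mul_nonneg hCP hc)
  exact mul_le_mul_of_nonneg_left (by nlinarith) (mul_nonneg hϱ hB₀)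

end

end Literature.MathematicalPhysics.QuantumFieldTheory.Balaban1983to89.B9PerturbationMajorantAlgebra
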